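import Literature.NumberTheory.Rogawski1990.UnitOrbitalIntegralInertCountJZeroTorus
import Literature.NumberTheory.Rogawski1990.UnitOrbitalIntegralInertCountJZeroLarge
import Literature.NumberTheory.Rogawski1990.UnitOrbitalIntegralInertFixedPointsSumThetaZero
import Literature.NumberTheory.Automorphic.UnitaryThreePHTowerPackage
import HarnessLib

/-!
# Flicker's Prop. 13 at the torus literal for EVERY level `m` (modulo the case-(e) count), and the `θ̄ = 0` value `X₁ = φ₀`
(Flicker (1998), *Elementary proof of the fundamental lemma for a unitary group*, Prop. 13 pp. 91–93, Prop. 14 p. 94)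

Topic `NumberTheory/Rogawski1990` (road «D-N7-inert», MAP v3 LAYER C, value `X₁`, layer T1b of census `F0/P3/F0P3b-p01/g6/CENSUS-LayerC-X1-ThetaZero.F0P3bp01g6.md`);
namespace `Literature.NumberTheory.Automorphic.UnitaryGroup`.  THEOREMS ONLY; kernel lane.  Pen F0P3b-p01 (g6).
HONEST LABEL: HC_CM is proved only modulo the 2 remaining named inputs (hLiu418, h413) until rung 0 closes.  ONE NAMED GAP threaded as a binder: the case-(e)
residue count `hce` (`N < m`, `M < 2m ≤ M + N`, `M − N` even; p04 (g12) ★ `natCard_cosets_jzero_eq_iThirteen_of_lt`'s hypothesis, precision `2m − N > m`).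

* `natCard_cosets_flickerTorusOne_eq_iThirteen_all` — `(#{y ∈ P_H ⧸ P_H ∩ H^K_m : y⁻¹ t y ∈ H^K_m} : ℚ) = iThirteen q N N₊ (max N₁ N₂) m` for ALL `m`, from Flicker's raw
  orders `N, N₊, N₁, N₂` and the type datum `(N₁ < N ∧ N₂ = N₁ ∧ N₊ = N₁) ∨ (N ≤ N₁ ∧ N ≤ N₊)` (★ `sumThetaZero_eq_phiZero`'s): `m ≤ N` ★ mine
  `natCard_cosets_flickerTorusOne_eq_iThirteen`; `N < m`, `N ≥ 1` ★ p04 `…_of_lt` (Prop. 8 numbers by ★ B-p04's package); `N = 0 < m` directly from ★ p04's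
  `natCard_cosets_jzero_bd` ∕ `…_eq_zero_of_far` (there `|f² − 1| = |ϖ^M|` may fail, only `≤` holds — enough).
* **`finsum_natCard_fixedPoints_flickerTorusOne_eq_phiZero`** — ★ T1a `finsum_natCard_fixedPoints_eq_phiZero_of_column` with its column binder `hI0` DISCHARGED:
  `Σᶠ_m #Fix_t(H ⧸ H^K_m) = phiZero q N₁ N₂ N` for `t = t(a,b,c)`, modulo `hce`.

## References
* [Flicker1998UnitaryFL] Y. Z. Flicker, *Elementary proof of the fundamental lemma for a unitary group*, Canad. J. Math. 50 (1998), 74–98.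
* [Rogawski1990] J. D. Rogawski, *Automorphic Representations of Unitary Groups in Three Variables* (1990), §4.9 p. 55.
-/

set_option autoImplicit false

open scoped MatrixGroups WithZero Valued
open Matrix

namespace Literature.NumberTheory.Automorphic

namespace UnitaryGroup

open Literature.NumberTheory.Automorphic.HermitianLattice (unitaryInt mem_unitaryInt_iff LocalConjDatum)
open Literature.NumberTheory.Rogawski1990.Flicker1998 (iThirteen phiZero natCast_count_c_eq)
open IsLocalRing

universe u

variable {K : Type*} [Field K] [Valued K ℤᵐ⁰] {ϖ : K} (σ : K →+* K) {J : Matrix (Fin 3) (Fin 3) K}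

section All

variable [IsDiscreteValuationRing 𝒪[K]] [Finite (ResidueField 𝒪[K])] [IsAdicComplete (maximalIdeal 𝒪[K]) 𝒪[K]]

/-- **PROP. 13 AT THE TORUS LITERAL, ALL LEVELS `m`** (modulo the case-(e) count `hce`). [cite: Flicker1998UnitaryFL, Prop. 13 pp. 91–93] -/
theorem natCard_cosets_flickerTorusOne_eq_iThirteen_all (hJ : J = (StdForm.antidiagonal 3).over K) (hd : LocalConjDatum σ ϖ)
    (hσO : ∀ y : 𝒪[K], (σ.comp 𝒪[K].subtype) y ∈ 𝒪[K]) {y : K} (hy : y * σ y = -2)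
    {c um t : ↥(unitaryGroupOfForm σ J)} (hc : ((c : GL (Fin 3) K) : Matrix (Fin 3) (Fin 3) K) = !![1, 0, 0; 0, -1, 0; 0, 0, 1])
    {m : ℕ} (hum : ((um : GL (Fin 3) K) : Matrix (Fin 3) (Fin 3) K) = !![ϖ ^ m, y, (ϖ ^ m)⁻¹; 0, 1, -σ y * (ϖ ^ m)⁻¹; 0, 0, (ϖ ^ m)⁻¹])
    {e a b cc : K} (h2e : 2 * e = 1) (ha : σ a * a = 1) (hb : σ b * b = 1) (hcc : σ cc * cc = 1)
    (hte : ((t : GL (Fin 3) K) : Matrix (Fin 3) (Fin 3) K) = !![e * (a + cc), 0, -(e * (a - cc)); 0, b, 0; -(e * (a - cc)), 0, e * (a + cc)])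
    (htH : t ∈ Subgroup.centralizer ({c} : Set ↥(unitaryGroupOfForm σ J)))
    {N Np N₁ N₂ : ℕ} (hN : Valued.v (a - cc) = Valued.v (ϖ ^ N)) (hNp : Valued.v (a + cc - 2 * b) = Valued.v (ϖ ^ Np))
    (hN₁ : Valued.v (a - b) = Valued.v (ϖ ^ N₁)) (hN₂ : Valued.v (cc - b) = Valued.v (ϖ ^ N₂))
    (h : (N₁ < N ∧ N₂ = N₁ ∧ Np = N₁) ∨ (N ≤ N₁ ∧ N ≤ Np))
    {q : ℕ} (hq : Nat.card (ResidueField 𝒪[K]) = q ^ 2)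
    {a₀ : 𝒪[K]} (ha₀ : IsUnit (((σ.comp 𝒪[K].subtype).codRestrict 𝒪[K] hσO) a₀ - a₀))
    (hce : N < m → N ≤ Np → max N₁ N₂ < 2 * m → 2 * m ≤ max N₁ N₂ + N → (max N₁ N₂ - N) % 2 = 0 →
      (∀ p ∈ flickerPH σ J c, ∀ u x w : K,
        ((p : GL (Fin 3) K) : Matrix (Fin 3) (Fin 3) K) = !![u, 0, u * x; 0, w, 0; 0, 0, (σ u)⁻¹] →
          (p⁻¹ * t * p ∈ flickerHK σ J c um ↔
            Valued.v (((u * σ u)⁻¹ + -(e * ((a + cc - 2 * b) / (a - cc) + σ ((a + cc - 2 * b) / (a - cc)))) + x) *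
                σ ((u * σ u)⁻¹ + -(e * ((a + cc - 2 * b) / (a - cc) + σ ((a + cc - 2 * b) / (a - cc)))) + x) -
              ((-(e * ((a + cc - 2 * b) / (a - cc) + σ ((a + cc - 2 * b) / (a - cc))))) ^ 2 - 1)) ≤ Valued.v (ϖ ^ (2 * m - N)))) →
      Nat.card {w : ↥(flickerPH σ J c) ⧸ (flickerHK σ J c um).subgroupOf (flickerPH σ J c) //
        ((Quotient.out w : ↥(flickerPH σ J c)) : ↥(unitaryGroupOfForm σ J))⁻¹ * t * (Quotient.out w : ↥(flickerPH σ J c)) ∈ flickerHK σ J c um} =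
        (q + 1) ^ 2 * q ^ (2 * m + N - 2)) :
    (Nat.card {w : ↥(flickerPH σ J c) ⧸ (flickerHK σ J c um).subgroupOf (flickerPH σ J c) //
      ((Quotient.out w : ↥(flickerPH σ J c)) : ↥(unitaryGroupOfForm σ J))⁻¹ * t * (Quotient.out w : ↥(flickerPH σ J c)) ∈ flickerHK σ J c um} : ℚ) =
      iThirteen q N Np (max N₁ N₂) m := by
  have h2v : Valued.v (2 : K) = 1 := hd.v2
  have h2 : (2 : K) ≠ 0 := fun h => by rw [h, map_zero] at h2v; exact zero_ne_one h2v
  have hϖ0 : ϖ ≠ 0 := hd.ϖ_ne_zero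
  have he0 : e ≠ 0 := fun h => by rw [h, mul_zero] at h2e; exact zero_ne_one h2e
  have hve : Valued.v e = 1 := by
    have := congrArg Valued.v h2e; rw [map_mul, h2v, one_mul, map_one] at this; exact this
  have ha0 : a ≠ 0 := fun h => by rw [h, mul_zero] at ha; exact zero_ne_one ha
  have hb0 : b ≠ 0 := fun h => by rw [h, mul_zero] at hb; exact zero_ne_one hb
  have hc0 : cc ≠ 0 := fun h => by rw [h, mul_zero] at hcc; exact zero_ne_one hcc
  have hvb : Valued.v b = 1 := by
    have h1 := congrArg Valued.v hb; rw [map_mul, hd.vσ, map_one] at h1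
    exact Literature.NumberTheory.QuadraticForms.OMeara65.WithZeroMulInt.eq_one_of_mul_self h1
  have hac : a ≠ cc := by
    intro h; rw [h, sub_self, map_zero] at hN; exact (pow_ne_zero _ hϖ0) ((map_eq_zero _).1 hN.symm)
  have hac' : a - cc ≠ 0 := sub_ne_zero.2 hac
  have hq0 : q ≠ 0 := by
    rintro rfl
    have h1 : 0 < Nat.card (ResidueField 𝒪[K]) := Nat.card_pos
    rw [hq] at h1; simp at h1
  have hq1 : 1 ≤ q := Nat.one_le_iff_ne_zero.2 hq0
  have vle : ∀ {i j : ℕ}, Valued.v (ϖ ^ i) ≤ Valued.v (ϖ ^ j) ↔ j ≤ i := fun {i j} => by rw [hd.v_pow, hd.v_pow, WithZero.exp_le_exp]; omega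
  have vlt : ∀ {i j : ℕ}, Valued.v (ϖ ^ i) < Valued.v (ϖ ^ j) ↔ j < i := fun {i j} => by rw [hd.v_pow, hd.v_pow, WithZero.exp_lt_exp]; omega
  -- the type datum in the adapter's currency: `min(N₁, N₂) = N` in type B
  have hreg : Np < N ∨ (N ≤ Np ∧ N ≤ max N₁ N₂ ∧ N₁ + N₂ = N + max N₁ N₂) := by
    rcases h with ⟨h1, h2', h3⟩ | ⟨h1, h2'⟩
    · exact Or.inl (by omega)
    · refine Or.inr ⟨h2', le_trans h1 (le_max_left _ _), ?_⟩
      have hsum : a - cc = (a - b) + (b - cc) := by ring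
      have hvbc : Valued.v (b - cc) = Valued.v (ϖ ^ N₂) := by rw [← Valuation.map_sub_swap, hN₂]
      rcases lt_trichotomy N₁ N₂ with hlt | heq | hgt
      · -- `|a−b| > |b−c|` ⟹ `N = N₁`
        have : Valued.v (a - cc) = Valued.v (a - b) := by
          rw [hsum]; exact Valuation.map_add_eq_of_lt_left _ (by rw [hvbc, hN₁, vlt]; exact hlt)
        rw [hN, hN₁, hd.v_pow, hd.v_pow, WithZero.exp_inj] at this
        rw [max_eq_right hlt.le]; omega
      · subst heq
        have hle : Valued.v (a - cc) ≤ Valued.v (ϖ ^ N₁) := by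
          rw [hsum]; exact le_trans (Valuation.map_add _ _ _) (max_le (le_of_eq hN₁) (le_of_eq hvbc))
        rw [hN, vle] at hle
        rw [max_self]; omega
      · have : Valued.v (a - cc) = Valued.v (b - cc) := by
          rw [hsum]; exact Valuation.map_add_eq_of_lt_right _ (by rw [hvbc, hN₁, vlt]; exact hgt)
        rw [hN, hvbc, hd.v_pow, hd.v_pow, WithZero.exp_inj] at this
        rw [max_eq_left hgt.le]; omega
  rcases Nat.lt_or_ge N m with hNm | hmN
  swap
  · exact natCard_cosets_flickerTorusOne_eq_iThirteen σ hJ hd hσO hy hc hum h2e ha hb hcc hte htH hmN hN hNp hN₁ hN₂ hreg hq ha₀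
  -- `N < m`: the split `(A − b)∕B = f + g`
  have hm : 1 ≤ m := by omega
  have hm0 : m ≠ 0 := by omega
  have hσa : σ a = a⁻¹ := eq_inv_of_mul_eq_one_left ha
  have hσb : σ b = b⁻¹ := eq_inv_of_mul_eq_one_left hb
  have hσc : σ cc = cc⁻¹ := eq_inv_of_mul_eq_one_left hcc
  set r : K := (a + cc - 2 * b) / (a - cc) with hr
  have hσrr : σ r - r = 2 * (a - b) * (cc - b) / (b * (a - cc)) := map_ratio_sub_ratio σ hσa hσb hσc ha0 hb0 hc0 hac
  set f : K := -(e * (r + σ r)) with hf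
  set g : K := e * (σ r - r) with hg
  have hAb : e * (a + cc) - b = e * (a + cc - 2 * b) := by linear_combination b * h2e
  have hdr : (e * (a + cc) - b) / (-(e * (a - cc))) = -r := by rw [hAb, hr]; field_simp
  have hfg : (e * (a + cc) - b) / (-(e * (a - cc))) = f + g := by rw [hdr, hf, hg]; linear_combination (r : K) * h2e
  have he2 : e = (2 : K)⁻¹ := by rw [← one_div, eq_div_iff h2, mul_comm]; exact h2e
  have hσe : σ e = e := by rw [he2, map_inv₀, map_ofNat]
  have hσf : σ f = f := by rw [hf, map_neg, map_mul, map_add, hd.σσ, hσe, add_comm]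
  have hσg : σ g = -g := by rw [hg, map_mul, map_sub, hd.σσ, hσe]; ring
  have hvB : Valued.v (-(e * (a - cc))) = Valued.v (ϖ ^ N) := by rw [Valuation.map_neg, map_mul, hve, one_mul, hN]
  have hB0 : -(e * (a - cc)) ≠ 0 := neg_ne_zero.2 (mul_ne_zero he0 hac')
  have hs : Valued.v (e * (a + cc) - b) = Valued.v (ϖ ^ Np) := by rw [hAb, map_mul, hve, one_mul, hNp]
  -- Prop. 8's numbers (★ B-p04's package)
  haveI := finite_quotient_flickerHK σ hJ hd hy hσO m hum hc hq ha₀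
  have hSN := inf_flickerHK_le_flickerPH0 σ hJ hd hy m hum hc
  have hfib := natCard_fibre_flickerPHRho_eq σ hJ hd hy hσO m hum hc hq ha₀
  rcases hreg with hA | ⟨hNNp, hNM, hsum⟩
  · -- type A with `N < m`: kill (p04's theorem; the split data are idle there)
    exact natCard_cosets_jzero_eq_iThirteen_of_lt σ hJ hd hσO hy hNm hc hum hte htH hvB (fun _ => hs) hfg hσf hσg
      (fun hle => absurd hle (by omega)) (Or.inl hA) hq ha₀ hSN hfib
      (fun hle => absurd hle (by omega))
  -- type B with `N < m`
  have hvr : Valued.v r ≤ 1 := by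
    rw [hr, map_div₀, hNp, hN, hd.v_pow, hd.v_pow, ← WithZero.exp_sub, ← WithZero.exp_zero, WithZero.exp_le_exp]; omega
  have hvσr : Valued.v (σ r) ≤ 1 := by rw [hd.vσ]; exact hvr
  have hf1 : Valued.v f ≤ 1 := by
    rw [hf, Valuation.map_neg, map_mul, hve, one_mul]
    exact le_trans (Valuation.map_add _ _ _) (max_le hvr hvσr)
  have hvgM : Valued.v g = Valued.v (ϖ ^ max N₁ N₂) := by
    rw [hg, map_mul, hve, one_mul, hσrr, map_div₀, map_mul, map_mul, map_mul, h2v, one_mul, hvb, one_mul, hN₁, hN₂, hN,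
      hd.v_pow, hd.v_pow, hd.v_pow, hd.v_pow, ← WithZero.exp_add, ← WithZero.exp_sub, WithZero.exp_inj]
    omega
  have hr2 : Valued.v (r ^ 2 - 1) = Valued.v (ϖ ^ (max N₁ N₂ - N)) := by
    rw [hr, ratio_sq_sub_one hac', map_div₀, map_mul, map_mul, map_pow, show (4 : K) = 2 * 2 by norm_num, map_mul, h2v, one_mul, one_mul,
      hN₁, hN₂, hN, hd.v_pow, hd.v_pow, hd.v_pow, hd.v_pow, ← WithZero.exp_add, ← WithZero.exp_nsmul, ← WithZero.exp_sub, WithZero.exp_inj]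
    simp only [nsmul_eq_mul, Nat.cast_ofNat]; omega
  have hfr : f = -r + (-g) := by rw [hf, hg]; linear_combination (-(r : K)) * h2e
  have hf2 : f ^ 2 - 1 = (r ^ 2 - 1) + g * (2 * r + g) := by rw [hfr]; ring
  have h2r : Valued.v (2 * r + g) ≤ 1 := le_trans (Valuation.map_add _ _ _)
    (max_le (by rw [map_mul, h2v, one_mul]; exact hvr) (by rw [hvgM]; exact hd.v_pow_le_one _))
  have hgsmall : Valued.v (g * (2 * r + g)) ≤ Valued.v (ϖ ^ max N₁ N₂) := by
    rw [map_mul, hvgM]; exact mul_le_of_le_one_right zero_le h2r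
  rcases Nat.eq_zero_or_pos N with hN0 | hN1
  · -- `N = 0 < m`: only (d) and the far zero occur; `|f² − 1| ≤ |ϖ^M|` suffices
    subst hN0
    have hc₁le : Valued.v (f ^ 2 - 1) ≤ Valued.v (ϖ ^ max N₁ N₂) := by
      rw [hf2]; refine le_trans (Valuation.map_add _ _ _) (max_le ?_ hgsmall); rw [hr2, Nat.sub_zero]
    have hvmm : Valued.v (ϖ ^ m) * Valued.v (ϖ ^ m) = Valued.v (ϖ ^ (2 * m)) := by rw [← map_mul, ← pow_add, two_mul]
    by_cases hbd : 2 * m ≤ max N₁ N₂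
    · have hcnt := natCard_cosets_jzero_bd σ hJ hd hσO hy hm (by omega) hc hum hte htH hvB hfg hσf hf1
        (le_trans hc₁le (by rw [vle]; omega)) (by rw [hvgM, vle]; omega) hq ha₀ hSN hfib
      rw [hcnt, cast_count_bd_eq hq1 hm (by omega), iThirteen, if_neg hm0, if_neg (by omega), if_neg (by omega), if_neg (by omega),
        if_pos ⟨hNNp, by omega, by omega⟩]
    · rw [natCard_cosets_jzero_eq_zero_of_far σ hJ hd hy m hc hum hte htH hB0 hfg hσf hσg
          (by rw [hvmm, hvB, hvgM, ← map_mul, ← pow_add, vlt]; omega),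
        Nat.cast_zero, iThirteen, if_neg hm0, if_neg (by omega), if_neg (by omega), if_neg (by omega), if_neg (by omega), if_neg (by omega)]
  · -- `1 ≤ N < m`: p04's packaging with the genuine split
    have hsmall : Valued.v (g * (2 * r + g)) < Valued.v (r ^ 2 - 1) := by
      rw [hr2]; exact lt_of_le_of_lt hgsmall (by rw [vlt]; omega)
    have hc₁ : Valued.v (f ^ 2 - 1) = Valued.v (ϖ ^ (max N₁ N₂ - N)) := by
      rw [hf2, Valuation.map_add_eq_of_lt_left _ hsmall, hr2]
    exact natCard_cosets_jzero_eq_iThirteen_of_lt σ hJ hd hσO hy hNm hc hum hte htH hvB (fun _ => hs) hfg hσf hσg (fun _ => hf1)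
      (Or.inr ⟨hNNp, hNM, hc₁, hvgM⟩) hq ha₀ hSN hfib (fun hge hM2 h2M hpar hcrit => hce hNm hge hM2 h2M hpar hcrit)

set_option synthInstance.maxHeartbeats 120000 in
-- the `MulAction` instance of `↥H` on `↥H ⧸ M` (as in ★ `natCard_fixedPoints_centralizer_eq_finsum`)
/-- **`X₁`: `Σᶠ_m #Fix_t(H ⧸ H^K_m) = φ₀(N₁, N₂, N)` for the torus `t(a,b,c)` (`θ̄ = 0`)** — ★ T1a `finsum_natCard_fixedPoints_eq_phiZero_of_column` with the `j = 0`
column discharged by `natCard_cosets_flickerTorusOne_eq_iThirteen_all`; the single remaining named input is the case-(e) count `hce` (one clause per level `m > N`).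
[cite: Flicker1998UnitaryFL, Prop. 5 p. 82; Cor. 9 p. 85; Prop. 10 p. 85; Prop. 13 pp. 91–93; Prop. 14 p. 94] -/
theorem finsum_natCard_fixedPoints_flickerTorusOne_eq_phiZero (hJ : J = (StdForm.antidiagonal 3).over K) (hd : LocalConjDatum σ ϖ)
    (hσO : ∀ y : 𝒪[K], (σ.comp 𝒪[K].subtype) y ∈ 𝒪[K]) {y : K} (hy : y * σ y = -2)
    {c : ↥(unitaryGroupOfForm σ J)} (hc : ((c : GL (Fin 3) K) : Matrix (Fin 3) (Fin 3) K) = !![1, 0, 0; 0, -1, 0; 0, 0, 1])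
    (u : ℕ → ↥(unitaryGroupOfForm σ J))
    (hum : ∀ m, ((u m : GL (Fin 3) K) : Matrix (Fin 3) (Fin 3) K) = !![ϖ ^ m, y, (ϖ ^ m)⁻¹; 0, 1, -σ y * (ϖ ^ m)⁻¹; 0, 0, (ϖ ^ m)⁻¹])
    {R : Type u} [CommRing R] [IsDomain R] [IsDiscreteValuationRing R] [Finite (ResidueField R)] (ι : R →+* K) (hι : Function.Injective ι)
    (hιv : ∀ x : K, Valued.v x ≤ 1 ↔ x ∈ Set.range ι) (σR : R →+* R) (hσR : ∀ r, σR (σR r) = r) (hσι : ∀ r, ι (σR r) = σ (ι r))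
    {dR : R} (hdRσ : σR dR = -dR) (hdRu : IsUnit dR) (h2R : IsUnit (2 : R)) {ϖR : R} (hϖR : Irreducible ϖR) (hιϖ : ι ϖR = ϖ)
    {q : ℕ} (hqR : Nat.card (ResidueField R) = q ^ 2) (hq : Nat.card (ResidueField 𝒪[K]) = q ^ 2)
    {a₀ : 𝒪[K]} (ha₀ : IsUnit (((σ.comp 𝒪[K].subtype).codRestrict 𝒪[K] hσO) a₀ - a₀))
    {e a b cc : K} (h2e : 2 * e = 1) (ha : σ a * a = 1) (hb : σ b * b = 1) (hcc : σ cc * cc = 1)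
    {t : ↥(unitaryGroupOfForm σ J)}
    (hte : ((t : GL (Fin 3) K) : Matrix (Fin 3) (Fin 3) K) = !![e * (a + cc), 0, -(e * (a - cc)); 0, b, 0; -(e * (a - cc)), 0, e * (a + cc)])
    (htH : t ∈ Subgroup.centralizer ({c} : Set ↥(unitaryGroupOfForm σ J)))
    (r : ℕ → ↥(Subgroup.centralizer ({c} : Set ↥(unitaryGroupOfForm σ J))))
    (hr : ∀ i, (((r i : ↥(unitaryGroupOfForm σ J)) : GL (Fin 3) K) : Matrix (Fin 3) (Fin 3) K) = !![(ϖ ^ i)⁻¹, 0, 0; 0, 1, 0; 0, 0, ϖ ^ i])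
    {N Np N₁ N₂ : ℕ} (hN : Valued.v (a - cc) = Valued.v (ϖ ^ N)) (hNp : Valued.v (a + cc - 2 * b) = Valued.v (ϖ ^ Np))
    (hN₁ : Valued.v (a - b) = Valued.v (ϖ ^ N₁)) (hN₂ : Valued.v (cc - b) = Valued.v (ϖ ^ N₂))
    (h : (N₁ < N ∧ N₂ = N₁ ∧ Np = N₁) ∨ (N ≤ N₁ ∧ N ≤ Np))
    (hce : ∀ m, N < m → N ≤ Np → max N₁ N₂ < 2 * m → 2 * m ≤ max N₁ N₂ + N → (max N₁ N₂ - N) % 2 = 0 →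
      (∀ p ∈ flickerPH σ J c, ∀ u' x w : K,
        ((p : GL (Fin 3) K) : Matrix (Fin 3) (Fin 3) K) = !![u', 0, u' * x; 0, w, 0; 0, 0, (σ u')⁻¹] →
          (p⁻¹ * t * p ∈ flickerHK σ J c (u m) ↔
            Valued.v (((u' * σ u')⁻¹ + -(e * ((a + cc - 2 * b) / (a - cc) + σ ((a + cc - 2 * b) / (a - cc)))) + x) *
                σ ((u' * σ u')⁻¹ + -(e * ((a + cc - 2 * b) / (a - cc) + σ ((a + cc - 2 * b) / (a - cc)))) + x) -
              ((-(e * ((a + cc - 2 * b) / (a - cc) + σ ((a + cc - 2 * b) / (a - cc))))) ^ 2 - 1)) ≤ Valued.v (ϖ ^ (2 * m - N)))) →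
      Nat.card {w : ↥(flickerPH σ J c) ⧸ (flickerHK σ J c (u m)).subgroupOf (flickerPH σ J c) //
        ((Quotient.out w : ↥(flickerPH σ J c)) : ↥(unitaryGroupOfForm σ J))⁻¹ * t * (Quotient.out w : ↥(flickerPH σ J c)) ∈ flickerHK σ J c (u m)} =
        (q + 1) ^ 2 * q ^ (2 * m + N - 2))
    (hfin : ∀ m, {x : ↥(Subgroup.centralizer ({c} : Set ↥(unitaryGroupOfForm σ J))) ⧸ (flickerHK σ J c (u m)).subgroupOf (Subgroup.centralizer ({c} : Set ↥(unitaryGroupOfForm σ J))) | (⟨t, htH⟩ : ↥(Subgroup.centralizer ({c} : Set ↥(unitaryGroupOfForm σ J)))) • x = x}.Finite) :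
    ∑ᶠ m, (Nat.card {x : ↥(Subgroup.centralizer ({c} : Set ↥(unitaryGroupOfForm σ J))) ⧸ (flickerHK σ J c (u m)).subgroupOf (Subgroup.centralizer ({c} : Set ↥(unitaryGroupOfForm σ J))) // (⟨t, htH⟩ : ↥(Subgroup.centralizer ({c} : Set ↥(unitaryGroupOfForm σ J)))) • x = x} : ℚ) = phiZero q N₁ N₂ N :=
  finsum_natCard_fixedPoints_eq_phiZero_of_column σ hJ hd hσO hy hc u hum ι hι hιv σR hσR hσι hdRσ hdRu h2R hϖR hιϖ hqR hq ha₀ h2e ha hb hcc hte htH r hr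
    hN hNp h (fun m => natCard_cosets_flickerTorusOne_eq_iThirteen_all σ hJ hd hσO hy hc (hum m) h2e ha hb hcc hte htH hN hNp hN₁ hN₂ h hq ha₀ (hce m)) hfin

end All

end UnitaryGroup

end Literature.NumberTheory.Automorphic
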